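import Literature.Topology.FourManifolds.HandleAttachingMapsAssoc
import HarnessLib

/-!
# Splitting a simultaneous attachment of handles, I: the pieces of `M ∪ (p, q)` inside `M ∪ p`
(helper file 1/3 of the NF6 brick for stub `stub_steinRealisation`, line `modp-braid-orbits` r11,
crux `ConvexBisection.AcyclicBisectionExists`, item stmt-SmoothPoincare4-10508; wave 1, lead c4)

Brick for the topological half of Baykur's Stein realisation
(`Literature.Geometry.Symplectic.steinRealisation_of_sorted_modelsOnFibred`, NF6): the Lefschetz
handlebody `X = X(F; P ++ N)` of a sorted word is `X₊ = X(F; P)` (the base with the POSITIVE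
handles) with the negative handles attached on top, `X = (Base g ∪ prefix handles) ∪ suffix
handles` — Kosinski's re-association *"handles of the same index can all be attached at the same
time"* (Kosinski 1993, VI (7.1); VII, proof of (1.2)) read backwards and for a whole sub-family at
once.  The tree's `HandleAttachingMapsAssoc.lean` treats ONE extra handle
(`MultiAttachmentData.isMultiAttachment_cons`, `isAttachment_lift_iff`); this file and its sequels
`…MultiAttachmentSplit.lean` (the assembled data `splitData`, `(M ∪ p) ∪ q = M ∪ (p, q)` as an
equivalence of the relational predicates, existence of the splitting, registered helper
`helper_isMultiAttachment_split`) and `…MultiAttachmentSplitLink.lean` (the case of a Lefschetz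
link over `Base g`, registered helper `helper_isMultiAttachment_split_append`) treat a finite
family of extra handles, by the same construction.

This file: given data `D₁` of `X₁ = M ∪_{p} (handles)` (`MultiAttachmentData`) and a second family
`q` whose ranges miss those of the `p̄ᵢ` — so that `j ↦ D₁.lift (q j)`, i.e. `jA ∘ q̄ⱼ`, is a family
of attaching maps of `X₁` (`MultiAttachmentData.lift`) — the pieces of the future presentation of
`X = M ∪ (p, q)` that live in `M` and in `X₁`:

* `pairwise_disjoint_sumElim`, `mem_coresComplement_sumElim_iff` — the combined family
  `Sum.elim p q` and its cores complement `M ∖ (⋃ p̄ᵢ(S) ∪ ⋃ q̄ⱼ(S))`;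
* `splitIncl` — the inclusion `M ∖ (⋃ p̄ᵢ(S) ∪ ⋃ q̄ⱼ(S)) ⊆ M ∖ ⋃ p̄ᵢ(S)`, an open embedding;
* `splitPtA` — `D₁.jA` on it, valued in `X₁ ∖ ⋃ⱼ jA(q̄ⱼ(S))`: an open topological embedding and
  an immersion at every point (`isImmersionAtOfComplement_splitPtA`, as the tree's
  `MultiAttachmentData.isImmersionAtOfComplement_consPtA`);
* `splitPtB i` — the old handle `D₁.jB i` valued in `X₁ ∖ ⋃ⱼ jA(q̄ⱼ(S))` (the old handles miss
  the lifted attaching spheres, `MultiAttachmentData.jB_not_mem_core_lift`), likewise;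
* `pairwise_disjoint_lift`, `pairwise_disjoint_of_lift`, registered helper
  `helper_pairwise_disjoint_lift_iff` — the lifted family `jA ∘ q̄ⱼ` has pairwise disjoint
  ranges iff `q̄` has (`jA` is injective).

Everything here is proved; no named facts are introduced.

## References
* A. A. Kosinski, *Differential Manifolds*, Academic Press (1993), VI §6, (7.1), VII proof of
  (1.2). [Kosinski1993]
* R. İ. Baykur, *Kähler decomposition of 4-manifolds*, AGT 6 (2006), proof of Thm. 5.1.
  [Baykur2006]
-/

noncomputable section

-- the prescribed namespace `Summit.<P>.<Sub>.…` duplicates `SmoothPoincare4` (P = Sub)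
set_option linter.dupNamespace false

open scoped Manifold ContDiff Topology

namespace Summit.SmoothPoincare4.SmoothPoincare4.Theorems.AcyclicBisectionExists.ModpBraidOrbits

open Set Function
open Literature.Topology.FourManifolds Literature.Topology.FourManifolds.HandleAttachingMap

universe u

section Split

variable {n k : ℕ} {M : Type u} [TopologicalSpace M] [T2Space M]
  [ChartedSpace (EuclideanHalfSpace (n + 1)) M]
  {ι₁ ι₂ : Type} [Finite ι₁] [Finite ι₂]
  {p : ι₁ → HandleAttachingMap n k M} {q : ι₂ → HandleAttachingMap n k M}

/-! ### The combined family `Sum.elim p q` and the inclusion of the cores complements -/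

omit [T2Space M] [Finite ι₁] [Finite ι₂] in
/-- The combined family `(p̄ᵢ, q̄ⱼ)` has pairwise disjoint ranges when `p̄`, `q̄` have and miss each
other. [folklore] -/
theorem pairwise_disjoint_sumElim
    (hp : Pairwise fun i j => Disjoint (range (p i).toFun) (range (p j).toFun))
    (hq : Pairwise fun i j => Disjoint (range (q i).toFun) (range (q j).toFun))
    (hqp : ∀ j i, Disjoint (range (q j).toFun) (range (p i).toFun)) :
    Pairwise fun x y => Disjoint (range (Sum.elim p q x).toFun) (range (Sum.elim p q y).toFun) := by
  rintro (i | j) (i' | j') hne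
  · exact hp fun c => hne (congrArg Sum.inl c)
  · exact (hqp j' i).symm
  · exact hqp j i'
  · exact hq fun c => hne (congrArg Sum.inr c)

/-- **Membership in `M ∖ (⋃ p̄ᵢ(S) ∪ ⋃ q̄ⱼ(S))`.** [folklore] -/
theorem mem_coresComplement_sumElim_iff {a : M} :
    a ∈ coresComplement (Sum.elim p q) ↔ a ∈ coresComplement p ∧ ∀ j, a ∉ (q j).core := by
  simp only [mem_coresComplement, Sum.forall, Sum.elim_inl, Sum.elim_inr]

/-- The inclusion `M ∖ (⋃ p̄ᵢ(S) ∪ ⋃ q̄ⱼ(S)) ⊆ M ∖ ⋃ p̄ᵢ(S)` on points. [folklore] -/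
def splitIncl (p : ι₁ → HandleAttachingMap n k M) (q : ι₂ → HandleAttachingMap n k M)
    (a : ↥(coresComplement (Sum.elim p q))) : ↥(coresComplement p) :=
  ⟨a, (mem_coresComplement_sumElim_iff.1 a.2).1⟩

/-- The underlying point of `splitIncl`. [folklore] -/
@[simp] theorem coe_splitIncl (a : ↥(coresComplement (Sum.elim p q))) :
    (splitIncl p q a : M) = a := rfl

/-- Points of `M ∖ (⋃ p̄ᵢ(S) ∪ ⋃ q̄ⱼ(S))` lie off the `q̄ⱼ(S)`. [folklore] -/
theorem not_mem_core_of_mem_coresComplement_sumElim (a : ↥(coresComplement (Sum.elim p q)))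
    (j : ι₂) : (a : M) ∉ (q j).core :=
  (mem_coresComplement_sumElim_iff.1 a.2).2 j

/-- `splitIncl` is continuous. [folklore] -/
theorem continuous_splitIncl : Continuous (splitIncl p q) :=
  continuous_subtype_val.subtype_mk _

/-- `splitIncl` is a topological embedding. [folklore] -/
theorem isEmbedding_splitIncl : Topology.IsEmbedding (splitIncl p q) :=
  Topology.IsEmbedding.of_comp continuous_splitIncl continuous_subtype_val
    Topology.IsEmbedding.subtypeVal

/-- The range of `splitIncl` is the open set `{x | ∀ j, x ∉ q̄ⱼ(S)}`. [folklore] -/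
theorem range_splitIncl : range (splitIncl p q) = Subtype.val ⁻¹' (⋃ j, (q j).core)ᶜ := by
  ext x
  simp only [mem_preimage, mem_compl_iff, mem_iUnion, not_exists]
  constructor
  · rintro ⟨a, rfl⟩
    exact not_mem_core_of_mem_coresComplement_sumElim a
  · intro hx
    exact ⟨⟨x, mem_coresComplement_sumElim_iff.2 ⟨x.2, hx⟩⟩, Subtype.ext rfl⟩

/-- … hence open. [folklore] -/
theorem isOpen_range_splitIncl : IsOpen (range (splitIncl p q)) := by
  rw [range_splitIncl]
  exact (isClosed_iUnion_of_finite fun j => (q j).isClosed_core).isOpen_compl.preimage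
    continuous_subtype_val

/-! ### The points of `X₁ ∖ ⋃ⱼ jA(q̄ⱼ(S))` coming from `M` and from the prefix handles -/

variable [IsManifold (𝓡∂ (n + 1)) ∞ M]
  {X₁ : Type*} [TopologicalSpace X₁] [T2Space X₁] [ChartedSpace (EuclideanHalfSpace (n + 1)) X₁]
  [IsManifold (𝓡∂ (n + 1)) ∞ X₁]
  (D₁ : MultiAttachmentData p (𝓡∂ (n + 1)) X₁)
  (hqp : ∀ j i, Disjoint (range (q j).toFun) (range (p i).toFun))

/-- `jA` of a point off all the `q̄ⱼ(S)` lies off all the lifted attaching spheres `jA(q̄ⱼ(S))`.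
[folklore] -/
theorem jA_splitIncl_mem (a : ↥(coresComplement (Sum.elim p q))) :
    D₁.jA (splitIncl p q a) ∈ coresComplement fun j => D₁.lift (q j) (hqp j) := by
  rw [mem_coresComplement]
  intro j
  rw [D₁.jA_mem_core_lift_iff (q j) (hqp j)]
  exact not_mem_core_of_mem_coresComplement_sumElim a j

/-- The point `jA a` of `X₁ ∖ ⋃ⱼ jA(q̄ⱼ(S))`, for `a ∈ M ∖ (⋃ p̄ᵢ(S) ∪ ⋃ q̄ⱼ(S))`. [folklore] -/
def splitPtA (a : ↥(coresComplement (Sum.elim p q))) :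
    ↥(coresComplement fun j => D₁.lift (q j) (hqp j)) :=
  ⟨D₁.jA (splitIncl p q a), jA_splitIncl_mem D₁ hqp a⟩

/-- The underlying point of `splitPtA`. [folklore] -/
@[simp] theorem coe_splitPtA (a : ↥(coresComplement (Sum.elim p q))) :
    (splitPtA D₁ hqp a : X₁) = D₁.jA (splitIncl p q a) := rfl

/-- `splitPtA` is continuous. [folklore] -/
theorem continuous_splitPtA : Continuous (splitPtA D₁ hqp) :=
  (D₁.hjA.isEmbedding.continuous.comp continuous_splitIncl).subtype_mk _

/-- `splitPtA` is a topological embedding. [folklore] -/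
theorem isEmbedding_splitPtA : Topology.IsEmbedding (splitPtA D₁ hqp) :=
  Topology.IsEmbedding.of_comp (continuous_splitPtA D₁ hqp) continuous_subtype_val
    (D₁.hjA.isEmbedding.comp isEmbedding_splitIncl)

/-- The range of `splitPtA` is open. [folklore] -/
theorem isOpen_range_splitPtA : IsOpen (range (splitPtA D₁ hqp)) := by
  have : range (splitPtA D₁ hqp) = Subtype.val ⁻¹' (D₁.jA '' range (splitIncl p q)) := by
    ext y
    constructor
    · rintro ⟨a, rfl⟩
      exact ⟨splitIncl p q a, mem_range_self a, rfl⟩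
    · rintro ⟨_, ⟨a, rfl⟩, hy⟩
      exact ⟨a, Subtype.ext hy⟩
  rw [this]
  exact (D₁.isOpenMap_jA _ isOpen_range_splitIncl).preimage continuous_subtype_val

/-- **`splitPtA` is an immersion at every point** (with the complement of `jA`): `jA`
precomposed with the inverse of the coercion chart of the open `M ∖ ⋃ p̄ᵢ(S)`, restricted to the
open `M ∖ (⋃ p̄ᵢ(S) ∪ ⋃ q̄ⱼ(S))` and corestricted to the open `X₁ ∖ ⋃ⱼ jA(q̄ⱼ(S))` (as
`MultiAttachmentData.isImmersionAtOfComplement_consPtA`). [folklore] -/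
theorem isImmersionAtOfComplement_splitPtA {F : Type*} [NormedAddCommGroup F] [NormedSpace ℝ F]
    (hF : ∀ x, Manifold.IsImmersionAtOfComplement F (𝓡∂ (n + 1)) (𝓡∂ (n + 1)) ∞ D₁.jA x)
    (a : ↥(coresComplement (Sum.elim p q))) :
    Manifold.IsImmersionAtOfComplement F (𝓡∂ (n + 1)) (𝓡∂ (n + 1)) ∞ (splitPtA D₁ hqp) a := by
  haveI hne : Nonempty ↥(coresComplement p) := ⟨splitIncl p q a⟩
  set c := (coresComplement p).openPartialHomeomorphSubtypeCoe hne with hc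
  have hΦ : ContMDiffOn (𝓡∂ (n + 1)) (𝓡∂ (n + 1)) ∞ c.symm c.symm.source :=
    contMDiffOn_openPartialHomeomorphSubtypeCoe_symm (coresComplement p) hne
  have hΦ' : ContMDiffOn (𝓡∂ (n + 1)) (𝓡∂ (n + 1)) ∞ c.symm.symm c.symm.target := by
    rw [OpenPartialHomeomorph.symm_symm, OpenPartialHomeomorph.symm_target]
    exact contMDiffOn_openPartialHomeomorphSubtypeCoe (coresComplement p) hne
  have hsrc : ((a : M)) ∈ c.symm.source := by
    rw [OpenPartialHomeomorph.symm_source,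
      TopologicalSpace.Opens.openPartialHomeomorphSubtypeCoe_target]
    exact (splitIncl p q a).2
  -- `jA ∘ c⁻¹ : M ⇀ X₁` is an immersion at `a`
  have h1 : Manifold.IsImmersionAtOfComplement F (𝓡∂ (n + 1)) (𝓡∂ (n + 1)) ∞ (D₁.jA ∘ c.symm)
      (a : M) :=
    (hF (c.symm (a : M))).comp_openPartialHomeomorph c.symm hΦ hΦ' hsrc
  -- restrict to the open `M ∖ (⋃ p̄ᵢ(S) ∪ ⋃ q̄ⱼ(S))`
  have h2 : Manifold.IsImmersionAtOfComplement F (𝓡∂ (n + 1)) (𝓡∂ (n + 1)) ∞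
      ((D₁.jA ∘ c.symm) ∘ Subtype.val : ↥(coresComplement (Sum.elim p q)) → X₁) a :=
    h1.comp_subtypeVal (coresComplement (Sum.elim p q))
  have h3 : Manifold.IsImmersionAtOfComplement F (𝓡∂ (n + 1)) (𝓡∂ (n + 1)) ∞
      (fun a' => D₁.jA (splitIncl p q a')) a := by
    refine h2.congr_of_eventuallyEq (Filter.Eventually.of_forall fun a' => ?_)
    show D₁.jA (c.symm (a' : M)) = D₁.jA (splitIncl p q a')
    congr 1
    have hmem : splitIncl p q a' ∈ c.source := by
      rw [TopologicalSpace.Opens.openPartialHomeomorphSubtypeCoe_source]; exact mem_univ _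
    have := c.left_inv hmem
    rw [TopologicalSpace.Opens.openPartialHomeomorphSubtypeCoe_coe] at this
    exact this
  -- corestrict to the open `X₁ ∖ ⋃ⱼ jA(q̄ⱼ(S))`
  exact h3.codRestrict_opens (coresComplement fun j => D₁.lift (q j) (hqp j))
    (jA_splitIncl_mem D₁ hqp)

/-- The point `jBᵢ b` of `X₁ ∖ ⋃ⱼ jA(q̄ⱼ(S))` (the old handles miss the lifted attaching spheres,
`MultiAttachmentData.jB_not_mem_core_lift`). [folklore] -/
def splitPtB (i : ι₁) (b : ↥(beltPiece n k)) :
    ↥(coresComplement fun j => D₁.lift (q j) (hqp j)) :=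
  ⟨D₁.jB i b, (mem_coresComplement _).2 fun j => D₁.jB_not_mem_core_lift (q j) (hqp j) i b⟩

/-- The underlying point of `splitPtB`. [folklore] -/
@[simp] theorem coe_splitPtB (i : ι₁) (b : ↥(beltPiece n k)) :
    (splitPtB D₁ hqp i b : X₁) = D₁.jB i b := rfl

/-- `splitPtBᵢ` is a topological embedding. [folklore] -/
theorem isEmbedding_splitPtB (i : ι₁) : Topology.IsEmbedding (splitPtB D₁ hqp i) :=
  Topology.IsEmbedding.of_comp (((D₁.hjB i).1.isEmbedding.continuous).subtype_mk _)
    continuous_subtype_val (D₁.hjB i).1.isEmbedding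

/-- The range of `splitPtBᵢ` is open. [folklore] -/
theorem isOpen_range_splitPtB (i : ι₁) : IsOpen (range (splitPtB D₁ hqp i)) := by
  have : range (splitPtB D₁ hqp i) = Subtype.val ⁻¹' range (D₁.jB i) := by
    ext y
    constructor
    · rintro ⟨b, rfl⟩; exact ⟨b, rfl⟩
    · rintro ⟨b, hb⟩; exact ⟨b, Subtype.ext hb⟩
  rw [this]
  exact (D₁.hjB i).2.preimage continuous_subtype_val

/-- `splitPtBᵢ` is an immersion at every point (with the complement of `jBᵢ`). [folklore] -/
theorem isImmersionAtOfComplement_splitPtB {F : Type*} [NormedAddCommGroup F] [NormedSpace ℝ F]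
    (i : ι₁)
    (hF : ∀ b, Manifold.IsImmersionAtOfComplement F (𝓡∂ (n + 1)) (𝓡∂ (n + 1)) ∞ (D₁.jB i) b)
    (b : ↥(beltPiece n k)) :
    Manifold.IsImmersionAtOfComplement F (𝓡∂ (n + 1)) (𝓡∂ (n + 1)) ∞ (splitPtB D₁ hqp i) b :=
  (hF b).codRestrict_opens (coresComplement fun j => D₁.lift (q j) (hqp j))
    fun b => (mem_coresComplement _).2 fun j => D₁.jB_not_mem_core_lift (q j) (hqp j) i b

omit [Finite ι₂] [T2Space X₁] in
/-- The lifted family `jA ∘ q̄ⱼ` has pairwise disjoint ranges when `q̄` has (`jA` is injective).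
[folklore] -/
theorem pairwise_disjoint_lift
    (hq : Pairwise fun j j' => Disjoint (range (q j).toFun) (range (q j').toFun)) :
    Pairwise fun j j' => Disjoint (range (D₁.lift (q j) (hqp j)).toFun)
      (range (D₁.lift (q j') (hqp j')).toFun) := by
  intro j j' hne
  refine Set.disjoint_left.2 ?_
  rintro _ ⟨y, rfl⟩ ⟨y', he⟩
  rw [MultiAttachmentData.lift_apply, MultiAttachmentData.lift_apply, D₁.injective_jA.eq_iff] at he
  have he' : (q j').toFun y' = (q j).toFun y := congrArg Subtype.val he
  exact Set.disjoint_left.1 (hq hne) (mem_range_self y) ⟨y', he'⟩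

omit [Finite ι₂] [T2Space X₁] in
/-- The `q̄ⱼ` have pairwise disjoint ranges when the lifted `jA ∘ q̄ⱼ` have. [folklore] -/
theorem pairwise_disjoint_of_lift
    (hd : Pairwise fun j j' => Disjoint (range (D₁.lift (q j) (hqp j)).toFun)
      (range (D₁.lift (q j') (hqp j')).toFun)) :
    Pairwise fun j j' => Disjoint (range (q j).toFun) (range (q j').toFun) := by
  intro j j' hne
  refine Set.disjoint_left.2 ?_
  rintro _ ⟨y, rfl⟩ ⟨y', he⟩
  refine Set.disjoint_left.1 (hd hne) (mem_range_self (f := (D₁.lift (q j) (hqp j)).toFun) y)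
    ⟨y', ?_⟩
  rw [MultiAttachmentData.lift_apply, MultiAttachmentData.lift_apply]
  congr 1
  exact Subtype.ext he

end Split

/-! ### The registered helper -/

/-- **Registered helper `helper_pairwise_disjoint_lift_iff` (sub-goal of NF6
`stub_steinRealisation`, wave 1, lead c4): the lifted family `jA ∘ q̄ⱼ` of attaching maps of
`X₁ = M ∪_{p} (handles)` has pairwise disjoint ranges iff `q̄` has** — the hypothesis under which
the suffix handles can be attached to `X₁` simultaneously (`jA` is injective;
`pairwise_disjoint_lift`, `pairwise_disjoint_of_lift`). [folklore] -/
theorem helper_pairwise_disjoint_lift_iff :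
    ∀ (n k : ℕ) (M : Type) [TopologicalSpace M] [T2Space M]
      [ChartedSpace (EuclideanHalfSpace (n + 1)) M] [IsManifold (𝓡∂ (n + 1)) ∞ M]
      (ι₁ ι₂ : Type) [Finite ι₁] (p : ι₁ → HandleAttachingMap n k M)
      (q : ι₂ → HandleAttachingMap n k M) (X₁ : Type) [TopologicalSpace X₁]
      [ChartedSpace (EuclideanHalfSpace (n + 1)) X₁] [IsManifold (𝓡∂ (n + 1)) ∞ X₁]
      (D₁ : HandleAttachingMap.MultiAttachmentData p (𝓡∂ (n + 1)) X₁)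
      (hqp : ∀ j i, Disjoint (Set.range (q j).toFun) (Set.range (p i).toFun)),
      (Pairwise fun j j' => Disjoint (Set.range (D₁.lift (q j) (hqp j)).toFun)
          (Set.range (D₁.lift (q j') (hqp j')).toFun)) ↔
        Pairwise fun j j' => Disjoint (Set.range (q j).toFun) (Set.range (q j').toFun) := by
  intro _ _ _ _ _ _ _ _ _ _ _ _ _ _ _ _ D₁ hqp
  exact ⟨pairwise_disjoint_of_lift D₁ hqp, pairwise_disjoint_lift D₁ hqp⟩

end Summit.SmoothPoincare4.SmoothPoincare4.Theorems.AcyclicBisectionExists.ModpBraidOrbits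

end
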